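import Literature.NumberTheory.LFunctions.ZetaUniversalityDenseness
import Literature.NumberTheory.LFunctions.MertensSecondLogPower
import Literature.Analysis.Complex.ExpTypeIndicator
import Literature.Analysis.Complex.MinModulusRealSegment
import HarnessLib

/-!
# Proof of Voronin's denseness lemma `Steuding2007_thm5_10_zeta_disc`

Topic `Literature/NumberTheory/LFunctions`. Everything in this file is PROVED; it discharges the
named fact `Literature.NumberTheory.LFunctions.Steuding2007_thm5_10_zeta_disc` (Steuding,
*Value-Distribution of L-Functions*, Thm. 5.10 for `L = ζ`, disc form (1.17)) by supplying the
analytic core `hcore` of the tree's reduction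
`Literature.NumberTheory.LFunctions.Steuding2007_thm5_10_zeta_disc_of_core` (Pechersky's theorem in
the `ℓ²` model of the Bergman space of the disc):

* `voronin_core` — **the positive-density step** (Steuding §5.4, (5.19)–(5.29), for `ζ`): an entire
  `ρ` with `‖ρ(z)‖ ≤ C e^{R‖z‖}`, `0 < R < c₀`, `c₀ + R < 1`, and `Σ_p p^{-c₀} ‖ρ(log p)‖ < ∞`
  vanishes identically.
* `Steuding2007_thm5_10_zeta_disc_holds` — the discharge.

Steuding's proof of this step uses Lemma 5.8 (the indicator of `ρ`: a non-zero `ρ` of exponential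
type `≤ R` has `limsup log ‖ρ(x)‖/x ≥ -R`) and V. Bernstein's theorem on the growth of entire
functions along real sequences (Thm. 5.9) applied to a density-one subsequence extracted from the
convergence of `Σ_p |ϱ(log p)|` with (5.10). We keep Lemma 5.8 (the tree's
`Literature.Analysis.Complex.eq_zero_of_norm_le_exp_of_decay`) and the arithmetic extraction, but
replace Bernstein's theorem by a local argument, as follows. Put `G(z) = ρ(z) e^{(1-c₀)z}` and let
`a = inf {t : ‖G(x)‖ ≤ C_t e^{tx} on x ≥ 0}`; by Lemma 5.8, `a ≥ 1 - c₀ - R > 0` unless `ρ ≡ 0`.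
For `δ = a/30` there are arbitrarily large `x` with `‖G(x)‖ > e^{(a-δ)x}`, while the
Phragmén–Lindelöf principle in the quadrants (`Literature.Analysis.Complex.norm_le_exp_of_re_nonneg`)
gives `‖G‖ ≤ e^{2δx + K₀} ‖G(x)‖` on `|z - x| ≤ 15`. The local minimum-modulus lemma
`Literature.Analysis.Complex.exists_Icc_norm_ge_of_norm_le` then produces an interval of length
`1/(12(U+1))`, `U = 2δx + K₀`, inside `[x - 1/2, x + 1/2]` on which `‖G‖ ≥ e^{-(7U+1)} ‖G(x)‖`.
On the other hand Mertens' theorem with error `O(1/log⁴)` (the tree's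
`Literature.NumberTheory.LFunctions.Mertens.abs_sum_primesLE_inv_sub_loglog_le`) shows that every
window `[u, u + 1/u²]` (`u` large) contains `log p` for a prime `p` with
`‖G(log p)‖ = p^{1-c₀} ‖ρ(log p)‖ ≤ C_w u³` (`exists_prime_log_mem_Icc`), because
`Σ_{u < log p ≤ u+1/u²} 1/p ≥ 1/(2u³)` while `Σ_p p^{-c₀}‖ρ(log p)‖` converges. Comparing the two
bounds at such a prime gives `(a - 15δ) x ≤ 3 log x + O(1)`, impossible for large `x`.

## References

* [Steuding2007] J. Steuding, *Value-Distribution of L-Functions*, LNM 1877, Springer 2007, §5.3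
  (Lemma 5.8, Thm. 5.9), §5.4 (Thm. 5.10 and its proof, (5.19)–(5.31)); §1.3 (1.17).
* [Kowalski2021] E. Kowalski, *An Introduction to Probabilistic Number Theory*, CUP 2021, §3.3
  (Lemma 3.3.2) and Appendix A.5.
* [Boas1954] R. P. Boas, *Entire Functions*, Academic Press 1954, §5.4, Ch. 10.
-/

noncomputable section

open Complex Filter Topology Set Metric Finset Real

namespace Literature.NumberTheory.LFunctions

/-! ### Primes in short logarithmic windows with a small value of `ρ` -/

/-- **Mertens in a window.** There is `u₀` such that for `u ≥ u₀` the primes `p` with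
`u < log p ≤ u + 1/u²` satisfy `Σ 1/p ≥ 1/(2u³)` (Mertens' second theorem with error
`O(1/log⁴ x)`). [cite: MontgomeryVaughan2007, Thm 2.7 (d) and §6.2] -/
theorem exists_sum_inv_primes_window_ge :
    ∃ u₀ : ℝ, 2 ≤ u₀ ∧ ∀ u : ℝ, u₀ ≤ u →
      1 / (2 * u ^ 3) ≤ ∑ p ∈ Nat.primesLE ⌊Real.exp (u + (u ^ 2)⁻¹)⌋₊ \ Nat.primesLE ⌊Real.exp u⌋₊,
        (p : ℝ)⁻¹ := by
  obtain ⟨K, hK⟩ := Mertens.abs_sum_primesLE_inv_sub_loglog_le 4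
  have hK0 : 0 ≤ K := by
    have h := hK 2 le_rfl
    have h1 : 0 ≤ K / Real.log 2 ^ 4 := (abs_nonneg _).trans h
    have h2 : 0 < Real.log 2 ^ 4 := pow_pos (Real.log_pos one_lt_two) 4
    by_contra hneg
    have : K / Real.log 2 ^ 4 < 0 := div_neg_of_neg_of_pos (not_le.1 hneg) h2
    linarith
  refine ⟨8 * K + 2, by linarith, fun u hu ↦ ?_⟩
  have hu2 : 2 ≤ u := by linarith
  have hu0 : 0 < u := by linarith
  set h : ℝ := (u ^ 2)⁻¹ with hh
  have hh0 : 0 < h := by positivity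
  set x₁ : ℝ := Real.exp u with hx₁
  set x₂ : ℝ := Real.exp (u + h) with hx₂
  have hx₁2 : 2 ≤ x₁ := by
    rw [hx₁]
    calc (2 : ℝ) ≤ u + 1 := by linarith
      _ ≤ Real.exp u := Real.add_one_le_exp u
  have hx₁₂ : x₁ ≤ x₂ := Real.exp_le_exp.2 (by linarith)
  have hx₂2 : 2 ≤ x₂ := hx₁2.trans hx₁₂
  have hsub : Nat.primesLE ⌊x₁⌋₊ ⊆ Nat.primesLE ⌊x₂⌋₊ :=
    Nat.primesLE_mono (Nat.floor_le_floor hx₁₂)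
  have hsplit := Finset.sum_sdiff hsub (f := fun p : ℕ ↦ (p : ℝ)⁻¹)
  have h1 := hK x₁ hx₁2
  have h2 := hK x₂ hx₂2
  rw [hx₁, Real.log_exp] at h1
  rw [hx₂, Real.log_exp] at h2
  rw [abs_le] at h1 h2
  -- the main term: `log(u+h) - log u ≥ h/(u+h)`
  have hmain : h / (u + h) ≤ Real.log (u + h) - Real.log u := by
    have hq : 0 < (u + h) / u := by positivity
    have := Real.one_sub_inv_le_log_of_pos hq
    rw [Real.log_div (by linarith) hu0.ne', inv_div] at this
    have e : 1 - u / (u + h) = h / (u + h) := by field_simp; ring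
    linarith
  -- error terms: `K/(u+h)^4 ≤ K/u^4`
  have herr : K / (u + h) ^ 4 ≤ K / u ^ 4 := by
    apply div_le_div_of_nonneg_left hK0 (by positivity)
    gcongr; linarith
  -- `h/(u+h) - 2K/u^4 ≥ 1/(2u³)` for `u ≥ 8K + 2`
  have hkey : 1 / (2 * u ^ 3) ≤ h / (u + h) - 2 * (K / u ^ 4) := by
    have e1 : h / (u + h) = 1 / (u ^ 3 + 1) := by rw [hh]; field_simp
    rw [e1]
    have hu4 : 0 < u ^ 4 := by positivity
    have hu31 : 0 < u ^ 3 + 1 := by positivity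
    have hP : 0 ≤ u ^ 4 - 4 * K * u ^ 3 - u - 4 * K := by
      have h3 : 0 ≤ u ^ 3 * (u - 8 * K - 2) := mul_nonneg (by positivity) (by linarith)
      have h4 : u ≤ u ^ 3 := by nlinarith
      nlinarith
    rw [show 2 * (K / u ^ 4) = 2 * K / u ^ 4 by ring, div_sub_div _ _ hu31.ne' hu4.ne',
      div_le_div_iff₀ (by positivity) (by positivity)]
    nlinarith [mul_nonneg (pow_nonneg hu0.le 3) hP]
  rw [← hsplit] at h2
  linarith [hmain, herr, hkey, h1.2, h2.1]

/-- **A prime in every short logarithmic window at which `ρ` is small.** If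
`Σ_p p^{-c₀} ‖ρ(log p)‖ < ∞`, then for `u ≥ u₀` there is a prime `p` with `u ≤ log p ≤ u + 1/u²`
and `p^{1-c₀} ‖ρ(log p)‖ ≤ C_w u³` (weighted pigeonhole against `Σ 1/p ≥ 1/(2u³)` over the window;
Steuding's (5.22)–(5.23) with all primes, `cos φ_p = 1`). [cite: Steuding2007, §5.4 (5.22)–(5.23)] -/
theorem exists_prime_log_mem_Icc {c₀ : ℝ} {ρ : ℂ → ℂ}
    (hsum : Summable (fun p : Nat.Primes ↦ ((p : ℕ) : ℝ) ^ (-c₀) * ‖ρ (Real.log p)‖)) :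
    ∃ Cw u₀ : ℝ, 0 < Cw ∧ 2 ≤ u₀ ∧ ∀ u : ℝ, u₀ ≤ u →
      ∃ p : ℕ, p.Prime ∧ u ≤ Real.log p ∧ Real.log p ≤ u + (u ^ 2)⁻¹ ∧
        (p : ℝ) ^ (1 - c₀) * ‖ρ (Real.log p)‖ ≤ Cw * u ^ 3 := by
  classical
  obtain ⟨u₀, hu₀, hwin⟩ := exists_sum_inv_primes_window_ge
  set S : ℝ := ∑' p : Nat.Primes, ((p : ℕ) : ℝ) ^ (-c₀) * ‖ρ (Real.log p)‖ with hS
  have hS0 : 0 ≤ S := by positivity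
  refine ⟨2 * S + 1, u₀, by positivity, hu₀, fun u hu ↦ ?_⟩
  have hu2 : 2 ≤ u := hu₀.trans hu
  have hm := hwin u hu
  set T : Finset ℕ := Nat.primesLE ⌊Real.exp (u + (u ^ 2)⁻¹)⌋₊ \ Nat.primesLE ⌊Real.exp u⌋₊ with hT
  set m : ℝ := ∑ p ∈ T, (p : ℝ)⁻¹ with hmdef
  have hm0 : 0 < m := lt_of_lt_of_le (by positivity) hm
  have hTne : T.Nonempty := by
    by_contra h
    rw [Finset.not_nonempty_iff_eq_empty] at h
    rw [hmdef, h, Finset.sum_empty] at hm0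
    exact lt_irrefl _ hm0
  have hTmem : ∀ p ∈ T, p.Prime ∧ u < Real.log p ∧ Real.log p ≤ u + (u ^ 2)⁻¹ := by
    intro p hp
    rw [hT, Finset.mem_sdiff, Nat.mem_primesLE, Nat.mem_primesLE] at hp
    obtain ⟨⟨hple, hpp⟩, hnot⟩ := hp
    have hp0 : (0 : ℝ) < p := by exact_mod_cast hpp.pos
    refine ⟨hpp, ?_, ?_⟩
    · have h0 : ¬ p ≤ ⌊Real.exp u⌋₊ := fun h ↦ hnot ⟨h, hpp⟩
      have h1 : Real.exp u < p := Nat.lt_of_floor_lt (not_le.1 h0)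
      calc u = Real.log (Real.exp u) := (Real.log_exp u).symm
        _ < Real.log p := Real.log_lt_log (Real.exp_pos u) h1
    · have h1 : (p : ℝ) ≤ Real.exp (u + (u ^ 2)⁻¹) := by
        calc (p : ℝ) ≤ ⌊Real.exp (u + (u ^ 2)⁻¹)⌋₊ := by exact_mod_cast hple
          _ ≤ Real.exp (u + (u ^ 2)⁻¹) := Nat.floor_le (Real.exp_pos _).le
      calc Real.log p ≤ Real.log (Real.exp (u + (u ^ 2)⁻¹)) := Real.log_le_log hp0 h1
        _ = u + (u ^ 2)⁻¹ := Real.log_exp _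
  set v : ℕ → ℝ := fun p ↦ (p : ℝ) ^ (-c₀) * ‖ρ (Real.log p)‖ with hv
  have hvS : ∑ p ∈ T, v p ≤ S := by
    have hprime : ∀ p ∈ T, p.Prime := fun p hp ↦ (hTmem p hp).1
    have hsum' : Summable ({q : ℕ | q.Prime}.indicator v) :=
      summable_subtype_iff_indicator.1 hsum
    have hv0 : ∀ q : ℕ, 0 ≤ v q := fun q ↦ by simp only [hv]; positivity
    calc ∑ p ∈ T, v p = ∑ p ∈ T, {q : ℕ | q.Prime}.indicator v p :=
          Finset.sum_congr rfl fun p hp ↦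
            (Set.indicator_of_mem (show p ∈ {q : ℕ | q.Prime} from hprime p hp) v).symm
      _ ≤ ∑' n, {q : ℕ | q.Prime}.indicator v n :=
          hsum'.sum_le_tsum T fun n _ ↦ Set.indicator_nonneg (fun q _ ↦ hv0 q) n
      _ = S := by rw [hS]; exact (tsum_subtype {q : ℕ | q.Prime} v).symm
  have hcmp : ∑ p ∈ T, v p ≤ ∑ p ∈ T, (S / m) * (p : ℝ)⁻¹ := by
    rw [← Finset.mul_sum, ← hmdef, div_mul_cancel₀ _ hm0.ne']
    exact hvS
  obtain ⟨p, hpT, hp⟩ := Finset.exists_le_of_sum_le hTne hcmp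
  obtain ⟨hpp, hlog1, hlog2⟩ := hTmem p hpT
  have hp0 : (0 : ℝ) < p := by exact_mod_cast hpp.pos
  refine ⟨p, hpp, hlog1.le, hlog2, ?_⟩
  have h1 : (p : ℝ) ^ (1 - c₀) * ‖ρ (Real.log p)‖ = p * v p := by
    simp only [hv]
    rw [← mul_assoc, show (1 - c₀ : ℝ) = 1 + (-c₀) by ring, Real.rpow_add hp0, Real.rpow_one]
  rw [h1]
  have h2 : (p : ℝ) * v p ≤ S / m := by
    calc (p : ℝ) * v p ≤ p * (S / m * (p : ℝ)⁻¹) := mul_le_mul_of_nonneg_left hp hp0.le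
      _ = S / m := by field_simp
  have h3 : S / m ≤ S * (2 * u ^ 3) := by
    rw [div_le_iff₀ hm0]
    calc S = S * (2 * u ^ 3) * (1 / (2 * u ^ 3)) := by field_simp
      _ ≤ S * (2 * u ^ 3) * m := mul_le_mul_of_nonneg_left hm (by positivity)
  have hu3 : 0 ≤ u ^ 3 := by positivity
  nlinarith

/-! ### The analytic core -/

/-- **The positive-density step of Voronin's theorem for `ζ` (Steuding §5.4, (5.19)–(5.29)).** Let
`0 < R < c₀`, `c₀ + R < 1`, and let `ρ` be entire with `‖ρ(z)‖ ≤ C e^{R‖z‖}` and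
`Σ_p p^{-c₀} ‖ρ(log p)‖ < ∞`. Then `ρ ≡ 0`. (In Steuding's notation `ϱ(z) = e^{-c₀ z} ρ(z) =
∫ e^{-sz} dμ(s)`: Lemma 5.8 gives `limsup log|ϱ(r)|/r > -1` for `ϱ ≠ 0`, and the convergence of
`Σ_p |ϱ(log p)|` with (5.10) and Thm. 5.9 gives `≤ -1`. Here Thm. 5.9 is replaced by the local
minimum-modulus lemma and Mertens' theorem in windows `[u, u+1/u²]`; see the module docstring.)
[cite: Steuding2007, Thm. 5.10 (proof, (5.19)–(5.29)), Lemma 5.8, Thm. 5.9] -/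
theorem voronin_core (c₀ R : ℝ) (hR : 0 < R) (hRc : R < c₀) (hcR : c₀ + R < 1)
    (ρ : ℂ → ℂ) (hρ : Differentiable ℂ ρ) (hbound : ∃ C : ℝ, ∀ z, ‖ρ z‖ ≤ C * Real.exp (R * ‖z‖))
    (hsum : Summable (fun p : Nat.Primes ↦ ((p : ℕ) : ℝ) ^ (-c₀) * ‖ρ (Real.log p)‖)) (z : ℂ) :
    ρ z = 0 := by
  obtain ⟨C, hC⟩ := hbound
  by_contra hne
  have hC0 : 0 ≤ C := Literature.Analysis.Complex.nonneg_of_norm_le_exp hC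
  -- the function `G(z) = ρ(z) e^{(1 - c₀) z}`
  set b : ℝ := 1 - c₀ with hb
  have hb0 : 0 < b := by rw [hb]; linarith
  set G : ℂ → ℂ := fun z ↦ ρ z * exp ((b : ℂ) * z) with hG
  have hGd : Differentiable ℂ G := hρ.mul (differentiable_id.const_mul _).cexp
  have hGnorm : ∀ z, ‖G z‖ = ‖ρ z‖ * Real.exp (b * z.re) := by
    intro z
    simp only [hG]
    rw [norm_mul, Complex.norm_exp, mul_re, ofReal_re, ofReal_im, zero_mul, sub_zero]
  have hGreal : ∀ x : ℝ, ‖G x‖ = ‖ρ x‖ * Real.exp (b * x) := by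
    intro x; rw [hGnorm, ofReal_re]
  have hGgrowth : ∀ z, ‖G z‖ ≤ C * Real.exp ((R + b) * ‖z‖) := by
    intro z
    rw [hGnorm]
    calc ‖ρ z‖ * Real.exp (b * z.re) ≤ C * Real.exp (R * ‖z‖) * Real.exp (b * ‖z‖) :=
          mul_le_mul (hC z) (Real.exp_le_exp.2 (mul_le_mul_of_nonneg_left (re_le_norm z) hb0.le))
            (Real.exp_pos _).le (mul_nonneg hC0 (Real.exp_pos _).le)
      _ = C * Real.exp ((R + b) * ‖z‖) := by rw [add_mul, Real.exp_add]; ring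
  have hGimag : ∀ y : ℝ, ‖G (y * I)‖ ≤ C * Real.exp (R * |y|) := by
    intro y
    rw [hGnorm, mul_I_re, ofReal_im, neg_zero, mul_zero, Real.exp_zero, mul_one]
    simpa using hC (y * I)
  -- the set of valid exponents on `ℝ₊`
  set V : Set ℝ := {t | ∃ C' : ℝ, ∀ x : ℝ, 0 ≤ x → ‖G x‖ ≤ C' * Real.exp (t * x)} with hV
  have hVmono : ∀ t ∈ V, ∀ t', t ≤ t' → t' ∈ V := by
    rintro t ⟨C', hC'⟩ t' htt'
    refine ⟨max C' 0, fun x hx ↦ (hC' x hx).trans ?_⟩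
    calc C' * Real.exp (t * x) ≤ max C' 0 * Real.exp (t * x) :=
          mul_le_mul_of_nonneg_right (le_max_left _ _) (Real.exp_pos _).le
      _ ≤ max C' 0 * Real.exp (t' * x) :=
          mul_le_mul_of_nonneg_left (Real.exp_le_exp.2 (mul_le_mul_of_nonneg_right htt' hx))
            (le_max_right _ _)
  have hbV : R + b ∈ V := by
    refine ⟨C, fun x hx ↦ ?_⟩
    have := hGgrowth x
    rwa [Complex.norm_real, Real.norm_eq_abs, abs_of_nonneg hx] at this
  set ε₀ : ℝ := b - R with hε₀
  have hε₀0 : 0 < ε₀ := by rw [hε₀, hb]; linarith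
  -- Lemma 5.8: every valid exponent is `≥ ε₀` (since `ρ ≠ 0`)
  have hlow : ∀ t ∈ V, ε₀ ≤ t := by
    rintro t ⟨C', hC'⟩
    by_contra hlt
    push Not at hlt
    apply hne
    refine Literature.Analysis.Complex.eq_zero_of_norm_le_exp_of_decay hρ hR.le hC (a := b - t)
      (C' := C') (by rw [hε₀] at hlt; linarith) (fun x hx ↦ ?_) z
    have h1 := hC' x hx
    rw [hGreal] at h1
    calc ‖ρ x‖ = ‖ρ x‖ * Real.exp (b * x) * Real.exp (-(b * x)) := by
          rw [mul_assoc, ← Real.exp_add, add_neg_cancel, Real.exp_zero, mul_one]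
      _ ≤ C' * Real.exp (t * x) * Real.exp (-(b * x)) :=
          mul_le_mul_of_nonneg_right h1 (Real.exp_pos _).le
      _ = C' * Real.exp (-((b - t) * x)) := by rw [mul_assoc, ← Real.exp_add]; ring_nf
  have hVne : V.Nonempty := ⟨_, hbV⟩
  have hVbdd : BddBelow V := ⟨ε₀, hlow⟩
  set a : ℝ := sInf V with ha
  have haε : ε₀ ≤ a := le_csInf hVne hlow
  have ha0 : 0 < a := hε₀0.trans_le haε
  set δ : ℝ := a / 30 with hδ
  have hδ0 : 0 < δ := by positivity
  have haδV : a + δ ∈ V := by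
    obtain ⟨t, htV, hlt⟩ := exists_lt_of_csInf_lt hVne (show sInf V < a + δ by linarith)
    exact hVmono t htV _ hlt.le
  have hnotV : a - δ ∉ V := fun h ↦ by
    have := csInf_le hVbdd h
    linarith
  obtain ⟨C₁, hC₁⟩ := haδV
  -- Phragmén–Lindelöf in the right half-plane, constant normalised to be `≥ 1`
  set Kc : ℝ := max (max C₁ C) 1 with hKc
  have hKc1 : 1 ≤ Kc := le_max_right _ _
  have hPL : ∀ w : ℂ, 0 ≤ w.re → ‖G w‖ ≤ Kc * Real.exp ((a + δ) * w.re + R * |w.im|) := by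
    intro w hw
    have h := Literature.Analysis.Complex.norm_le_exp_of_re_nonneg hGd hGgrowth hC₁ hGimag hw
    exact h.trans (mul_le_mul_of_nonneg_right (le_max_left _ _) (Real.exp_pos _).le)
  -- the arithmetic input
  obtain ⟨Cw, u₀, hCw, hu₀, hwin⟩ := exists_prime_log_mem_Icc hsum
  -- constants and the threshold `X`
  set K₀ : ℝ := Real.log Kc + 15 * (a + δ) + 15 * R with hK₀
  have hK₀0 : 0 ≤ K₀ := by
    have := Real.log_nonneg hKc1
    rw [hK₀]; positivity
  set Λ : ℝ := 7 * K₀ + Real.log Cw + a / 8 - 3 * Real.log (a / 12) with hΛ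
  set X : ℝ := max (max 16 (u₀ + 1)) (max (96 * δ + 12 * K₀ + 16) (4 * max Λ 0 / a + 1)) with hX
  have hX16 : 16 ≤ X := (le_max_left _ _).trans' (le_max_left _ _)
  have hXu₀ : u₀ + 1 ≤ X := (le_max_left _ _).trans' (le_max_right _ _)
  have hX3 : 96 * δ + 12 * K₀ + 16 ≤ X := (le_max_right _ _).trans' (le_max_left _ _)
  have hX4 : 4 * max Λ 0 / a + 1 ≤ X := (le_max_right _ _).trans' (le_max_right _ _)
  -- a point `x > X` where `G` is large
  have hbig : ∃ x : ℝ, X < x ∧ Real.exp ((a - δ) * x) < ‖G x‖ := by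
    by_contra hcon
    push Not at hcon
    apply hnotV
    refine ⟨max 1 (max C₁ 0 * Real.exp ((a + δ) * X)), fun x hx ↦ ?_⟩
    rcases le_or_gt x X with hxX | hxX
    · calc ‖G x‖ ≤ C₁ * Real.exp ((a + δ) * x) := hC₁ x hx
        _ ≤ max C₁ 0 * Real.exp ((a + δ) * X) := by
            refine mul_le_mul (le_max_left _ _) (Real.exp_le_exp.2 ?_) (Real.exp_pos _).le
              (le_max_right _ _)
            exact mul_le_mul_of_nonneg_left hxX (by linarith)
        _ ≤ max 1 (max C₁ 0 * Real.exp ((a + δ) * X)) * 1 := by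
            rw [mul_one]; exact le_max_right _ _
        _ ≤ max 1 (max C₁ 0 * Real.exp ((a + δ) * X)) * Real.exp ((a - δ) * x) := by
            refine mul_le_mul_of_nonneg_left ?_ (le_trans zero_le_one (le_max_left _ _))
            rw [Real.one_le_exp_iff]    -- name?
            exact mul_nonneg (by linarith) hx
    · calc ‖G x‖ ≤ Real.exp ((a - δ) * x) := hcon x hxX
        _ = 1 * Real.exp ((a - δ) * x) := (one_mul _).symm
        _ ≤ max 1 (max C₁ 0 * Real.exp ((a + δ) * X)) * Real.exp ((a - δ) * x) :=
            mul_le_mul_of_nonneg_right (le_max_left _ _) (Real.exp_pos _).le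
  obtain ⟨x, hxX, hGx⟩ := hbig
  have hx16 : 16 ≤ x := by linarith
  have hx0 : 0 < x := by linarith
  have hGx_pos : 0 < ‖G x‖ := (Real.exp_pos _).trans hGx
  have hGx_ne : G x ≠ 0 := norm_pos_iff.1 hGx_pos
  -- `U` and the local hypothesis on `|w - x| ≤ 15`
  set U : ℝ := 2 * δ * x + K₀ with hU
  have hU0 : 0 ≤ U := by rw [hU]; positivity
  have hlocal : ∀ w ∈ closedBall (x : ℂ) 15, ‖G w‖ ≤ Real.exp U * ‖G x‖ := by
    intro w hw
    rw [mem_closedBall, dist_eq_norm] at hw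
    have hre : |w.re - x| ≤ 15 := by
      have := abs_re_le_norm (w - x)
      rw [sub_re, ofReal_re] at this
      exact this.trans hw
    have him : |w.im| ≤ 15 := by
      have := abs_im_le_norm (w - x)
      rw [sub_im, ofReal_im, sub_zero] at this
      exact this.trans hw
    rw [abs_le] at hre
    have hw0 : 0 ≤ w.re := by linarith
    have h1 := hPL w hw0
    have h2 : (a + δ) * w.re + R * |w.im| ≤ (a + δ) * (x + 15) + 15 * R := by
      have : (a + δ) * w.re ≤ (a + δ) * (x + 15) := mul_le_mul_of_nonneg_left (by linarith) (by linarith)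
      nlinarith
    calc ‖G w‖ ≤ Kc * Real.exp ((a + δ) * (x + 15) + 15 * R) :=
          h1.trans (mul_le_mul_of_nonneg_left (Real.exp_le_exp.2 h2) (by linarith))
      _ = Real.exp U * Real.exp ((a - δ) * x) := by
          rw [← Real.exp_log (by linarith : 0 < Kc), ← Real.exp_add, ← Real.exp_add, hU, hK₀]
          congr 1
          ring
      _ ≤ Real.exp U * ‖G x‖ := mul_le_mul_of_nonneg_left hGx.le (Real.exp_pos _).le
  -- the local minimum-modulus lemma
  obtain ⟨t₀, ht₀₁, ht₀₂, hmin⟩ :=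
    Literature.Analysis.Complex.exists_Icc_norm_ge_of_norm_le hGd hU0 hGx_ne hlocal
  set ℓ : ℝ := 1 / (12 * (U + 1)) with hℓ
  have hℓ0 : 0 < ℓ := by positivity
  have ht₀0 : 0 < t₀ := by linarith
  have ht₀u₀ : u₀ ≤ t₀ := by linarith
  have ht₀x : t₀ ≤ x + 1 / 2 := by linarith
  -- the window `[t₀, t₀ + 1/t₀²]` fits into `[t₀, t₀ + ℓ]`
  have hwin_le : (t₀ ^ 2)⁻¹ ≤ ℓ := by
    rw [hℓ, inv_eq_one_div]
    apply one_div_le_one_div_of_le (by positivity)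
    -- `12 (U + 1) ≤ (x - 1/2)² ≤ t₀²`
    have h1 : (x - 1 / 2) ^ 2 ≤ t₀ ^ 2 := pow_le_pow_left₀ (by linarith) ht₀₁ 2
    have h2 : 12 * (U + 1) ≤ (x - 1 / 2) ^ 2 := by
      rw [hU]
      have h3 : x / 4 * (96 * δ + 12 * K₀ + 16) ≤ x / 4 * x :=
        mul_le_mul_of_nonneg_left (by linarith) (by linarith)
      have h4 : 4 * K₀ ≤ x * K₀ := mul_le_mul_of_nonneg_right (by linarith) hK₀0
      have h5 : 0 ≤ δ * x := by positivity
      nlinarith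
    linarith
  obtain ⟨p, hpp, hlogp₁, hlogp₂, hsmall⟩ := hwin t₀ ht₀u₀
  have hp0 : (0 : ℝ) < p := by exact_mod_cast hpp.pos
  have hlogp₂' : Real.log p ≤ t₀ + ℓ := hlogp₂.trans (by linarith)
  -- lower bound at `log p`
  have hlow_p := hmin (Real.log p) hlogp₁ hlogp₂'
  -- `‖G (log p)‖ = p^{1-c₀} ‖ρ(log p)‖ ≤ Cw t₀³ ≤ Cw (x + 1/2)³`
  have hGlogp : ‖G (Real.log p)‖ = (p : ℝ) ^ (1 - c₀) * ‖ρ (Real.log p)‖ := by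
    rw [hGreal, Real.rpow_def_of_pos hp0, hb, mul_comm (Real.log p) (1 - c₀), mul_comm]
  have hup : ‖G (Real.log p)‖ ≤ Cw * (x + 1 / 2) ^ 3 := by
    rw [hGlogp]
    exact hsmall.trans (mul_le_mul_of_nonneg_left (pow_le_pow_left₀ ht₀0.le ht₀x 3) hCw.le)
  -- compare: `e^{(a-δ)x - (7U+1)} < Cw (x+1/2)³`
  have hcomp : Real.exp ((a - δ) * x - (7 * U + 1)) < Cw * (x + 1 / 2) ^ 3 := by
    calc Real.exp ((a - δ) * x - (7 * U + 1))
        = Real.exp (-(7 * U + 1)) * Real.exp ((a - δ) * x) := by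
          rw [← Real.exp_add]
          congr 1
          ring
      _ < Real.exp (-(7 * U + 1)) * ‖G x‖ := mul_lt_mul_of_pos_left hGx (Real.exp_pos _)
      _ ≤ ‖G (Real.log p)‖ := hlow_p
      _ ≤ Cw * (x + 1 / 2) ^ 3 := hup
  -- take logarithms
  have hx12 : 0 < x + 1 / 2 := by linarith
  have hlogcomp : (a - δ) * x - (7 * U + 1) < Real.log Cw + 3 * Real.log (x + 1 / 2) := by
    have h := Real.log_lt_log (Real.exp_pos _) hcomp
    rwa [Real.log_exp, Real.log_mul hCw.ne' (by positivity), Real.log_pow] at h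
  -- `3 log(x + 1/2) ≤ (a/4)(x + 1/2) - 3 - 3 log(a/12)`
  have hlogx : 3 * Real.log (x + 1 / 2) ≤ a / 4 * (x + 1 / 2) - 3 - 3 * Real.log (a / 12) := by
    have hy : 0 < a / 12 * (x + 1 / 2) := by positivity
    have h1 := Real.log_le_sub_one_of_pos hy
    rw [Real.log_mul (by positivity) hx12.ne'] at h1
    linarith
  -- contradiction with `x > X ≥ 4 max Λ 0 / a + 1`
  have hfin : a / 4 * x < Λ := by
    rw [hΛ]
    rw [hU, hδ] at hlogcomp
    linarith
  have hΛle : Λ ≤ max Λ 0 := le_max_left _ _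
  have hxΛ : 4 * max Λ 0 / a + 1 < x := lt_of_le_of_lt hX4 hxX
  have : max Λ 0 < a / 4 * x := by
    have h1 : 4 * max Λ 0 / a < x := by linarith
    rw [div_lt_iff₀ ha0] at h1
    linarith
  linarith

/-! ### The discharge -/

/-- **Voronin's denseness lemma (Steuding Thm. 5.10 for `ζ`, disc form (1.17)) — discharge of the
named fact `Steuding2007_thm5_10_zeta_disc`.** The tree's reduction
`Steuding2007_thm5_10_zeta_disc_of_core` (Pechersky's theorem in the `ℓ²` disc model, Steuding
Thm. 5.4/5.7 and §5.4 (5.30)–(5.31)) applied to the analytic core `voronin_core`.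
[cite: Steuding2007, Thm. 5.10 and §1.3 (1.17)] -/
theorem Steuding2007_thm5_10_zeta_disc_holds : Steuding2007_thm5_10_zeta_disc :=
  Steuding2007_thm5_10_zeta_disc_of_core fun c₀ R hR hRc hcR ρ hρ hb hs z ↦
    voronin_core c₀ R hR hRc hcR ρ hρ hb hs z

end Literature.NumberTheory.LFunctions
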